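import Summits.QuantumFields.BalabanUV.T4Continuum.Support.DirichletFreeTower

/-!
# T⁴ programme, spine node NE2 (U1a), sub-row Δ1 «NE2⁰-Dirichlet» — NON-VACUITY / CONSISTENCY WITNESS for the END
# `DirichletFreeTower.freeTowerLaws_dirichlet_of_injected`: for the WHOLE torus as the region (`S₀ = ⊤`) the displayed binder
# `hinj` (injected two-level law of the Dirichlet tower) IS A THEOREM, with the torus constant `CJ·L^{−k}`

Eleventh generation of the NE2 prover lineage P1 of the cell `pub-balaban` (row NE2 owner), file 5.  The END of file 4b takes the
injected law of the Ω-restricted tower as a binder (the typed wall of Δ1).  This file checks the wiring on the one region where the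
law is already in the tree: `S₀ = ⊤` (every unit block), for which the compressed objects are re-indexings of the torus objects and
`hinj` is `KingPairingPlantedLaw.injected_le_lev` read through `SubtypeCompression.opNorm_toBlock_le`:

 * §1 `inReg ⊤ k` holds everywhere (`inReg_top`); compression along an everywhere-true predicate commutes with inverses
   (`inv_toBlock_of_forall`) and with the tower's products;
 * §2 **`injected_top`**: `‖(DalevR ⊤ (k+1))⁻¹·JpcTR ⊤ k − JpcTR ⊤ k·(DalevR ⊤ k)⁻¹‖ ≤ CJ·L^{−k}`; hence **`freeTowerLaws_dirichlet_top`**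
   (the END of file 4b with its binder DISCHARGED at `S₀ = ⊤`) and **`towerLimitRate_dirichlet_top`** (rate `L⁻¹`).

So the binder of the END is satisfiable and, on the torus, the Dirichlet tower law reduces to tier A's free law — nothing more is
claimed: for a PROPER region `hinj` remains the located gap (file 4b docstring).

HONEST FRAMING (T4-DAG p. 1).  `U = 1`, finite torus, linear layer, operator norm; [folklore] bookkeeping over landed modules;
NE2 (U1a) NOT proved; spine 0/9 unchanged; NOT infinite volume, NOT a mass gap, NOT the Clay problem, NOT summit progress.
HONEST DEPENDENCY: continuum YM on T⁴ ⇐ BetaPertH ∧ nine spine estimates (0/9 proved); BetaPertH ⇐ (D1) ∧ (D4) ∧ CAP+tail; G-an2-4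
gates asym, D1 and NE2/3/4.  No `sorry`.
-/

noncomputable section

open scoped BigOperators ComplexConjugate Matrix Matrix.Norms.L2Operator
open Filter Topology

namespace Summit.QuantumFields.BalabanUV.T4Continuum.DirichletFreeTowerTop

open Literature.MathematicalPhysics.QuantumFieldTheory.Balaban1983to89.B5Prop11Plancherel (Cst Cst_nonneg Tor fine)
open Literature.MathematicalPhysics.QuantumFieldTheory.Balaban1983to89.B5G183RateUnitTower (lev lev_neZero)
open Summit.QuantumFields.BalabanUV.T4Continuum
open Summit.QuantumFields.BalabanUV.T4Continuum.CovariantAveragingTower (TowerLimitRate)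
open Summit.QuantumFields.BalabanUV.T4Continuum.BalabanAveragedTowerUnit (idx Qlev)
open Summit.QuantumFields.BalabanUV.T4Continuum.BackgroundResolventTower
open Summit.QuantumFields.BalabanUV.T4Continuum.KingPairingPlantedLaw (JpcT calDalev isUnit_det_calDalev injected_le_lev CJ CJ_nonneg)
open Summit.QuantumFields.BalabanUV.T4Continuum.SubtypeCompression
open Summit.QuantumFields.BalabanUV.T4Continuum.DirichletRegionTower
open Summit.QuantumFields.BalabanUV.T4Continuum.DirichletFreeTower
open Summit.QuantumFields.BalabanUV.T4Continuum.PerturbationAlgebra (perturbationLaws_zero)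

variable {d : ℕ} (L : ℕ) [NeZero L] (M : Fin d → ℕ) [hM : ∀ μ, NeZero (M μ)] (a : ℝ) (ha : 0 < a)

/-! ## §1 The whole torus as a region -/

/-- the everywhere-true unit-lattice predicate (the whole torus as ONE region). [folklore] -/
abbrev top : idx L M 0 → Prop := fun _ => True

omit [NeZero L] hM in
/-- every level-`k` site belongs to the region generated by `⊤`. [folklore] -/
theorem inReg_top : ∀ (k : ℕ) (x : idx L M k), inReg L M (top L M) k x
  | 0, _ => trivial
  | k + 1, y => inReg_top k (BalabanAveragedTowerModes.par (lev L k) L M y.1, y.2)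

section Generic

variable {m : Type*} [Fintype m] [DecidableEq m] (p : m → Prop) [DecidablePred p]

/-- along an everywhere-true predicate, compression commutes with the inverse of an invertible matrix. [folklore] -/
theorem inv_toBlock_of_forall (hp : ∀ x, p x) {X : Matrix m m ℂ} (hX : IsUnit X.det) :
    (X.toBlock p p)⁻¹ = X⁻¹.toBlock p p := by
  refine Matrix.inv_eq_right_inv ?_
  rw [← toBlock_mul_of_vanish_left p p p X X⁻¹ (fun i j _ hj => absurd (hp j) hj), Matrix.mul_nonsing_inv X hX, toBlock_one]

end Generic

/-! ## §2 The injected law on the whole torus, and the END with its binder discharged -/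

/-- `(DalevR ⊤ k)⁻¹ = (𝒢^{(k)})_{⊤⊤}`. [folklore] -/
theorem DalevR_top_inv (k : ℕ) :
    (DalevR L M a ha (top L M) k)⁻¹ = ((calDalev L M a ha k)⁻¹).toBlock (inReg L M (top L M) k) (inReg L M (top L M) k) :=
  inv_toBlock_of_forall _ (inReg_top L M k) (isUnit_det_calDalev L M a ha k)

/-- **THE INJECTED LAW HOLDS ON THE WHOLE TORUS**: `‖(DalevR ⊤ (k+1))⁻¹·JpcTR ⊤ k − JpcTR ⊤ k·(DalevR ⊤ k)⁻¹‖ ≤ CJ·L^{−k}` — the torus law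
`KingPairingPlantedLaw.injected_le_lev` compressed along the everywhere-true predicate. [cite: King1986, p.664, Lemma 4.5 (4.38) p.674 (shape)] [folklore] -/
theorem injected_top (k : ℕ) :
    ‖(DalevR L M a ha (top L M) (k + 1))⁻¹ * JpcTR L M (top L M) k - JpcTR L M (top L M) k * (DalevR L M a ha (top L M) k)⁻¹‖
      ≤ CJ d a * ((L : ℝ)⁻¹) ^ k := by
  have e : (DalevR L M a ha (top L M) (k + 1))⁻¹ * JpcTR L M (top L M) k - JpcTR L M (top L M) k * (DalevR L M a ha (top L M) k)⁻¹
      = ((calDalev L M a ha (k + 1))⁻¹ * JpcT L M k - JpcT L M k * (calDalev L M a ha k)⁻¹).toBlock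
          (inReg L M (top L M) (k + 1)) (inReg L M (top L M) k) := by
    rw [DalevR_top_inv, DalevR_top_inv, JpcTR, toBlock_sub,
      toBlock_mul_of_vanish_left _ (inReg L M (top L M) (k + 1)) _ _ _ (fun i j _ hj => absurd (inReg_top L M (k + 1) j) hj),
      toBlock_mul_of_vanish_left _ (inReg L M (top L M) k) _ _ _ (fun i j _ hj => absurd (inReg_top L M k j) hj)]
  rw [e]
  exact (opNorm_toBlock_le _ _ _).trans (injected_le_lev L M a ha k)

/-- **THE END OF FILE 4b WITH ITS BINDER DISCHARGED AT `S₀ = ⊤`**: the Ω-restricted free tower laws for the whole torus, with the torus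
injected constant `CJ·L^{−k}`. [folklore] -/
theorem freeTowerLaws_dirichlet_top :
    FreeTowerLaws (DalevR L M a ha (top L M)) (QlevR L M (top L M)) (JpcTR L M (top L M)) (fun _ => 0) ((L : ℝ) ^ d)
      (fun k => 2 * d * (((d : ℝ) + 1) * Cst d a) * ((L : ℝ)⁻¹) ^ k) (fun k => CJ d a * ((L : ℝ)⁻¹) ^ k) (fun _ => 0) :=
  freeTowerLaws_dirichlet_of_injected L M a ha (top L M) (injected_top L M a ha)

/-- … hence the whole-torus Dirichlet tower converges at the rate of record `L⁻¹` (`L ≥ 2`). [folklore] -/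
theorem towerLimitRate_dirichlet_top (hL : 2 ≤ L) :
    TowerLimitRate (QlevR L M (top L M)) ((L : ℝ) ^ d) (fun k => (DalevR L M a ha (top L M) k)⁻¹)
      (Cpert 0 (2 * d * (((d : ℝ) + 1) * Cst d a)) (CJ d a) 0 0 0) ((L : ℝ)⁻¹) :=
  towerLimitRate_dirichlet_of_injected L M a ha (top L M) le_rfl
    (inv_lt_one_of_one_lt₀ (by exact_mod_cast (lt_of_lt_of_le one_lt_two hL : 1 < L))) (injected_top L M a ha)

end Summit.QuantumFields.BalabanUV.T4Continuum.DirichletFreeTowerTop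

end
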